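import Literature.NumberTheory.Rogawski1990.CartanRealisation
import Literature.NumberTheory.Rogawski1990.MatchingAdeleGLConj
import Literature.LinearAlgebra.Matrix.HermitianAdjointCartanAlgebra
import HarnessLib

/-!
# The ADELIC Cartan class `x(p) = H⁻¹ · ᵗ(σ̄ g) H g ∈ Z_{M₃(𝔸_L)}(γ₀ ⊗ 1)` of a matching adèle `p = g (γ₀ ⊗ 1) g⁻¹` over a regular `γ₀ ∈ U(H)(L⁺)`:
# well defined modulo norms, constant on `U(H)(𝐀)`-classes, PRINCIPAL on rational classes (Rogawski 1990, §3.3 (3.3.1) p. 22, §3.5 p. 29; Kottwitz 1986 §9)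

Topic `NumberTheory/Rogawski1990`; namespace `Literature.NumberTheory.Rogawski1990`; **THEOREMS ONLY** (no definition, no named fact, no instance, no
notation, no `sorry`).  Cell `pub/hodgecm-mathlib`, ENGINE T1 (crux H413 = `stmt-HodgeConjecture-24833`), row G6, sub-row R6d-β of
`CENSUS-R6R7-CartanObstruction.F0P5a-p03g4` (777973b4): the def-free API of the adelic Cartan class, = ★ R1 `CartanInvariant` ∕ ★ R2 `CartanAlgebra` ∕ ★ R6a
`CartanRealisation` instantiated at the ring `R := 𝔸_L` (involution ★ `adeleConj L = c ⊗ 1`, form `H ⊗ 1`; ★ `adelicUnitaryGroup L H` IS ★ `unitaryGroup (adeleConj L)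
(H ⊗ 1)`), with the adelic conjugators supplied by ★ R6b `MatchingAdeleG₂.exists_gl_conj_eq_adele` (A-p10).  The DEF `cartanObs` (R6d) reads this class through the
factor idèles of ★ R3′ and the indicators of ★ R6c; R7 (`CartanObsHasse`) consumes §3 for Prop. 3.3.1 (←).  HC_CM is proved only modulo the printed citations until
rung 0 closes.

THE PRINT.  [Rogawski1990, §3.3 p. 22] «`obs(γ′) ∈ A(G_γ^d)` … the image of the class `{τ(g)g⁻¹}` for `γ′ = gγg⁻¹`» and [Kottwitz1986, §9]: for `γ′ = g (γ ⊗ 1) g⁻¹`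
ADELICALLY stably conjugate to the rational `γ`, the cocycle `g⁻¹ τ(g)` with values in `T(𝐀̄)`; in the form language of ★ R1 this is the transported Gram matrix
`(H ⊗ 1)_g` modulo `Z(γ ⊗ 1)`-equivalence, i.e. the `⋆`-symmetric unit `x = (H ⊗ 1)⁻¹ (H ⊗ 1)_g` of the adelic Cartan algebra modulo norms `t⋆ x t`.

* §1 the adelic form: `adeleConj_adeleConj` (`(c ⊗ 1)² = 1`), `conjTranspose_adelicForm` (`H ⊗ 1` is `c ⊗ 1`-hermitian), `isUnit_det_adelicForm`,
  `twistGram_map_adele` (`(H_g) ⊗ 1 = (H ⊗ 1)_{g ⊗ 1}`, ★ `twistGram_map`).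
* §2 for ONE adelic conjugator `g` of `p` (`g (γ₀ ⊗ 1) g⁻¹ = p`): `x_g := (H ⊗ 1)⁻¹ (H ⊗ 1)_g` COMMUTES with `γ₀ ⊗ 1`, is `⋆`-symmetric, has `det x_g = N(det g)`
  (★ R1 ∕ R2 ∕ R6a verbatim); TWO conjugators give `x_{g′} = t⋆ x_g t` with `t ∈ Z(γ₀ ⊗ 1)` (`exists_commute_adelicCartan_eq_of_conj_eq`); conjugators of
  `U(H)(𝐀)`-CONJUGATE matching adèles too (`exists_commute_adelicCartan_eq_of_isConjAdele`) — the class is a CLASS FUNCTION on `𝒞′_𝐀(γ₀)`.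
* §3 **RATIONAL classes have PRINCIPAL Cartan class**: if `p` is rational over `γ` then `γ = g₀ γ₀ g₀⁻¹` for some `g₀ ∈ GL₃(L)` (★ `isStablyConj_of_isRationalOver`)
  and `x_g = t⋆ · ((H⁻¹ H_{g₀}) ⊗ 1) · t` (`exists_commute_adelicCartan_eq_map_of_isRationalOver`) — the input of Prop. 3.3.1 (←): the obstruction of a rational
  class is the image of a GLOBAL class, killed by every character (reciprocity).

## References
* [Rogawski1990] J. D. Rogawski, *Automorphic Representations of Unitary Groups in Three Variables*, Ann. of Math. Stud. 123 (1990), §3.3 (3.3.1), Prop. 3.3.1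
  p. 22; §3.5 Prop. 3.5.2 p. 29; §5.4 p. 72.
* [Kottwitz1986] R. E. Kottwitz, *Stable trace formula: elliptic singular terms*, Math. Ann. 275 (1986), §7, §9.
-/

set_option autoImplicit false

noncomputable section

open NumberField IsDedekindDomain
open scoped Matrix MatrixGroups

namespace Literature.NumberTheory.Rogawski1990

open Literature.NumberTheory.Automorphic
open Literature.AlgebraicGeometry.ShimuraVarieties (unitaryGroup mem_unitaryGroup_iff)

/-! ## §1 The adelic form `H ⊗ 1` over `(𝔸_L, c ⊗ 1)` -/

section AdelicForm

variable (L : Type) [Field L] [NumberField L] [IsCMField L] {n : Type} [Fintype n] [DecidableEq n]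

/-- `(c ⊗ 1) ∘ (c ⊗ 1) = id` on `𝔸_L`. [cite: Rogawski1990, §3.3 p. 21] -/
theorem adeleConj_adeleConj (z : AdeleRing (𝓞 L) L) : adeleConj L (adeleConj L z) = z := by
  have hcc : IsCMField.complexConj L * IsCMField.complexConj L = 1 := AlgEquiv.ext fun x => IsCMField.complexConj_apply_apply L x
  rw [adeleConj_apply, adeleConj_apply, smul_smul, hcc, one_smul]

variable {L}

omit [Fintype n] [DecidableEq n] in
/-- `H ⊗ 1` is `(c ⊗ 1)`-hermitian when `H` is `c`-hermitian. [cite: Rogawski1990, §3.3 p. 21] -/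
theorem conjTranspose_adelicForm {H : Matrix n n L} (hH : (H.map (cmConjRingHom L))ᵀ = H) :
    ((H.map (algebraMap L (AdeleRing (𝓞 L) L))).map (adeleConj L))ᵀ = H.map (algebraMap L (AdeleRing (𝓞 L) L)) := by
  have hcomp : (H.map (algebraMap L (AdeleRing (𝓞 L) L))).map (adeleConj L) = (H.map (cmConjRingHom L)).map (algebraMap L (AdeleRing (𝓞 L) L)) := by
    ext i j
    simp only [Matrix.map_apply, adeleConj_algebraMap]
  rw [hcomp, ← Matrix.transpose_map, hH]

omit [IsCMField L] in
/-- `det (H ⊗ 1)` is a unit when `det H` is. [cite: Rogawski1990, §3.3 p. 21] -/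
theorem isUnit_det_adelicForm {H : Matrix n n L} (hH : IsUnit H.det) : IsUnit (H.map (algebraMap L (AdeleRing (𝓞 L) L))).det := by
  rw [← RingHom.mapMatrix_apply, ← RingHom.map_det]
  exact hH.map _

omit [DecidableEq n] in
/-- **`(H_g) ⊗ 1 = (H ⊗ 1)_{g ⊗ 1}`**: the transported Gram matrix commutes with `L → 𝔸_L` (★ `twistGram_map`, ★ `adeleConj_algebraMap`).
[cite: Rogawski1990, §3.3 p. 21] -/
theorem twistGram_map_adele (H g : Matrix n n L) :
    (twistGram (cmConjRingHom L) H g).map (algebraMap L (AdeleRing (𝓞 L) L)) =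
      twistGram (adeleConj L) (H.map (algebraMap L (AdeleRing (𝓞 L) L))) (g.map (algebraMap L (AdeleRing (𝓞 L) L))) :=
  twistGram_map (cmConjRingHom L) H (adeleConj L) (algebraMap L (AdeleRing (𝓞 L) L)) (fun r => (adeleConj_algebraMap L r).symm) g

end AdelicForm

/-! ## §2 The adelic Cartan class of a matching adèle, for a given adelic conjugator -/

section Self

variable {L : Type} [Field L] [NumberField L] [IsCMField L] {H : Matrix (Fin 3) (Fin 3) L} {γ₀ : (UnitaryGroup.cmDatum L 3 H).Rational}

/-- The diagonal image `γ₀ ⊗ 1` and a matching adèle are BOTH `(c ⊗ 1)`-unitary for `H ⊗ 1` — the letters in which ★ R1 reads them: as elements of ★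
`unitaryGroup (adeleConj L) (H ⊗ 1)` (`= adelicUnitaryGroup L H` by definition). [cite: Rogawski1990, §3.3 p. 21] -/
theorem MatchingAdeleG₂.adele_val_mem_unitaryGroup (p : MatchingAdeleG₂ L H H γ₀) :
    (p.adele.val : GL (Fin 3) (AdeleRing (𝓞 L) L)) ∈ unitaryGroup (adeleConj L) (H.map (algebraMap L (AdeleRing (𝓞 L) L))) :=
  p.adele.2

/-- `γ₀ ⊗ 1 ∈ U(H ⊗ 1)(𝔸)`. [cite: Rogawski1990, §3.3 p. 21] -/
theorem toAdelic_val_mem_unitaryGroup (γ : (UnitaryGroup.cmDatum L 3 H).Rational) :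
    (((UnitaryGroup.cmDatum L 3 H).toAdelic γ).val : GL (Fin 3) (AdeleRing (𝓞 L) L)) ∈ unitaryGroup (adeleConj L) (H.map (algebraMap L (AdeleRing (𝓞 L) L))) :=
  ((UnitaryGroup.cmDatum L 3 H).toAdelic γ).2

/-- **`x_g := (H ⊗ 1)⁻¹ (H ⊗ 1)_g` commutes with `γ₀ ⊗ 1`** for every adelic conjugator `g` of `p` (★ R1 `commute_inv_mul_twistGram` at `R := 𝔸_L`): the class lives in
the adelic Cartan algebra `Z_{M₃(𝔸_L)}(γ₀ ⊗ 1)`. [cite: Rogawski1990, §3.3 (3.3.1) p. 22; §3.5 p. 29] -/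
theorem commute_adelicCartan (hH : IsUnit H.det) (p : MatchingAdeleG₂ L H H γ₀) {g : GL (Fin 3) (AdeleRing (𝓞 L) L)}
    (hg : g * (((UnitaryGroup.cmDatum L 3 H).toAdelic γ₀).val : GL (Fin 3) (AdeleRing (𝓞 L) L)) * g⁻¹ = (p.adele.val : GL (Fin 3) (AdeleRing (𝓞 L) L))) :
    Commute ((H.map (algebraMap L (AdeleRing (𝓞 L) L)))⁻¹ * twistGram (adeleConj L) (H.map (algebraMap L (AdeleRing (𝓞 L) L))) (g : Matrix (Fin 3) (Fin 3) (AdeleRing (𝓞 L) L)))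
      ((((UnitaryGroup.cmDatum L 3 H).toAdelic γ₀).val : GL (Fin 3) (AdeleRing (𝓞 L) L)) : Matrix (Fin 3) (Fin 3) (AdeleRing (𝓞 L) L)) :=
  commute_inv_mul_twistGram (adeleConj L) (H.map (algebraMap L (AdeleRing (𝓞 L) L))) (isUnit_det_adelicForm hH)
    (γ := ⟨_, toAdelic_val_mem_unitaryGroup γ₀⟩) (δ := ⟨_, p.adele_val_mem_unitaryGroup⟩) hg

/-- **`x_g` is `⋆`-symmetric** (`H` hermitian invertible; ★ R2 `hermStar_inv_mul_twistGram` at `R := 𝔸_L`). [cite: Rogawski1990, §3.5 p. 29] -/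
theorem hermStar_adelicCartan (hH : (H.map (cmConjRingHom L))ᵀ = H) (hHu : IsUnit H.det) (g : Matrix (Fin 3) (Fin 3) (AdeleRing (𝓞 L) L)) :
    hermStar (adeleConj L) (H.map (algebraMap L (AdeleRing (𝓞 L) L)))
        ((H.map (algebraMap L (AdeleRing (𝓞 L) L)))⁻¹ * twistGram (adeleConj L) (H.map (algebraMap L (AdeleRing (𝓞 L) L))) g) =
      (H.map (algebraMap L (AdeleRing (𝓞 L) L)))⁻¹ * twistGram (adeleConj L) (H.map (algebraMap L (AdeleRing (𝓞 L) L))) g :=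
  hermStar_inv_mul_twistGram (adeleConj L) _ (isUnit_det_adelicForm hHu) (adeleConj_adeleConj L) (conjTranspose_adelicForm hH) g

/-- **`det x_g = (c ⊗ 1)(det g) · det g`** — an adelic NORM (★ R6a `det_inv_mul_twistGram`): the source of `obs ∈ A(T) = {∑ ε = 0}`.
[cite: Rogawski1990, §3.5 Prop. 3.5.2 p. 29] -/
theorem det_adelicCartan (hH : IsUnit H.det) (g : Matrix (Fin 3) (Fin 3) (AdeleRing (𝓞 L) L)) :
    ((H.map (algebraMap L (AdeleRing (𝓞 L) L)))⁻¹ * twistGram (adeleConj L) (H.map (algebraMap L (AdeleRing (𝓞 L) L))) g).det = adeleConj L g.det * g.det :=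
  det_inv_mul_twistGram (adeleConj L) _ (isUnit_det_adelicForm hH) g

/-- **Two adelic conjugators give norm-equivalent classes**: `g (γ₀ ⊗ 1) g⁻¹ = p = g′ (γ₀ ⊗ 1) g′⁻¹` ⇒ `x_{g′} = t⋆ x_g t` for some `t ∈ GL₃(𝔸_L)` commuting with
`γ₀ ⊗ 1` (★ R1 `exists_commute_eq_mul_of_conj_eq`, ★ R2 `inv_mul_twistGram_mul`). [cite: Rogawski1990, §3.3 (3.3.1) p. 22] [cite: Kottwitz1986, §9] -/
theorem exists_commute_adelicCartan_eq_of_conj_eq (hH : IsUnit H.det) (p : MatchingAdeleG₂ L H H γ₀) {g g' : GL (Fin 3) (AdeleRing (𝓞 L) L)}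
    (hg : g * (((UnitaryGroup.cmDatum L 3 H).toAdelic γ₀).val : GL (Fin 3) (AdeleRing (𝓞 L) L)) * g⁻¹ = (p.adele.val : GL (Fin 3) (AdeleRing (𝓞 L) L)))
    (hg' : g' * (((UnitaryGroup.cmDatum L 3 H).toAdelic γ₀).val : GL (Fin 3) (AdeleRing (𝓞 L) L)) * g'⁻¹ = (p.adele.val : GL (Fin 3) (AdeleRing (𝓞 L) L))) :
    ∃ t : GL (Fin 3) (AdeleRing (𝓞 L) L),
      t * (((UnitaryGroup.cmDatum L 3 H).toAdelic γ₀).val : GL (Fin 3) (AdeleRing (𝓞 L) L)) =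
          (((UnitaryGroup.cmDatum L 3 H).toAdelic γ₀).val : GL (Fin 3) (AdeleRing (𝓞 L) L)) * t ∧
        (H.map (algebraMap L (AdeleRing (𝓞 L) L)))⁻¹ * twistGram (adeleConj L) (H.map (algebraMap L (AdeleRing (𝓞 L) L))) (g' : Matrix (Fin 3) (Fin 3) (AdeleRing (𝓞 L) L)) =
          hermStar (adeleConj L) (H.map (algebraMap L (AdeleRing (𝓞 L) L))) (t : Matrix (Fin 3) (Fin 3) (AdeleRing (𝓞 L) L)) *
            ((H.map (algebraMap L (AdeleRing (𝓞 L) L)))⁻¹ * twistGram (adeleConj L) (H.map (algebraMap L (AdeleRing (𝓞 L) L))) (g : Matrix (Fin 3) (Fin 3) (AdeleRing (𝓞 L) L))) *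
            (t : Matrix (Fin 3) (Fin 3) (AdeleRing (𝓞 L) L)) := by
  obtain ⟨t, ht, rfl⟩ := exists_commute_eq_mul_of_conj_eq hg hg'
  exact ⟨t, ht, by rw [Units.val_mul, inv_mul_twistGram_mul (adeleConj L) _ (isUnit_det_adelicForm hH)]⟩

/-- **The class is a CLASS FUNCTION on `𝒞′_𝐀(γ₀)`**: for `U(H)(𝐀)`-conjugate matching adèles `p ∼ q` and adelic conjugators `g` of `p`, `g′` of `q`, again `x_{g′} = t⋆ x_g t`
with `t ∈ Z(γ₀ ⊗ 1)` (left unitary invariance ★ `twistGram_unitary_mul`). [cite: Rogawski1990, §3.3 (3.3.1) p. 22; §5.4 p. 72] -/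
theorem exists_commute_adelicCartan_eq_of_isConjAdele (hH : IsUnit H.det) {p q : MatchingAdeleG₂ L H H γ₀} (hpq : p.IsConjAdele q)
    {g g' : GL (Fin 3) (AdeleRing (𝓞 L) L)}
    (hg : g * (((UnitaryGroup.cmDatum L 3 H).toAdelic γ₀).val : GL (Fin 3) (AdeleRing (𝓞 L) L)) * g⁻¹ = (p.adele.val : GL (Fin 3) (AdeleRing (𝓞 L) L)))
    (hg' : g' * (((UnitaryGroup.cmDatum L 3 H).toAdelic γ₀).val : GL (Fin 3) (AdeleRing (𝓞 L) L)) * g'⁻¹ = (q.adele.val : GL (Fin 3) (AdeleRing (𝓞 L) L))) :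
    ∃ t : GL (Fin 3) (AdeleRing (𝓞 L) L),
      t * (((UnitaryGroup.cmDatum L 3 H).toAdelic γ₀).val : GL (Fin 3) (AdeleRing (𝓞 L) L)) =
          (((UnitaryGroup.cmDatum L 3 H).toAdelic γ₀).val : GL (Fin 3) (AdeleRing (𝓞 L) L)) * t ∧
        (H.map (algebraMap L (AdeleRing (𝓞 L) L)))⁻¹ * twistGram (adeleConj L) (H.map (algebraMap L (AdeleRing (𝓞 L) L))) (g' : Matrix (Fin 3) (Fin 3) (AdeleRing (𝓞 L) L)) =
          hermStar (adeleConj L) (H.map (algebraMap L (AdeleRing (𝓞 L) L))) (t : Matrix (Fin 3) (Fin 3) (AdeleRing (𝓞 L) L)) *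
            ((H.map (algebraMap L (AdeleRing (𝓞 L) L)))⁻¹ * twistGram (adeleConj L) (H.map (algebraMap L (AdeleRing (𝓞 L) L))) (g : Matrix (Fin 3) (Fin 3) (AdeleRing (𝓞 L) L))) *
            (t : Matrix (Fin 3) (Fin 3) (AdeleRing (𝓞 L) L)) := by
  -- `q = u p u⁻¹` with `u ∈ U(H)(𝐀)`; `u g` conjugates `γ₀ ⊗ 1` to `q` and `x_{ug} = x_g`
  obtain ⟨u, hu⟩ := isConj_iff.mp hpq
  have hu' : (u.val : GL (Fin 3) (AdeleRing (𝓞 L) L)) * (p.adele.val : GL (Fin 3) (AdeleRing (𝓞 L) L)) * (u.val : GL (Fin 3) (AdeleRing (𝓞 L) L))⁻¹ =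
      (q.adele.val : GL (Fin 3) (AdeleRing (𝓞 L) L)) := by
    have := congrArg (fun a : (UnitaryGroup.cmDatum L 3 H).Adelic => (a.val : GL (Fin 3) (AdeleRing (𝓞 L) L))) hu
    exact this
  obtain ⟨hug, hx⟩ := twistGram_eq_of_unitary_conj (adeleConj L) (H.map (algebraMap L (AdeleRing (𝓞 L) L))) (γ := ((UnitaryGroup.cmDatum L 3 H).toAdelic γ₀).val)
    u.2 hg
  rw [hu'] at hug
  obtain ⟨t, ht, hcl⟩ := exists_commute_adelicCartan_eq_of_conj_eq hH q hug hg'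
  refine ⟨t, ht, ?_⟩
  rw [hcl, hx]

/-! ## §3 Rational classes have principal Cartan class -/

/-- **RATIONAL ⇒ PRINCIPAL**: if `p` is rational over `γ` and `g₀ γ₀ g₀⁻¹ = γ` in `GL₃(L)` (such `g₀` exists by ★ `isStablyConj_of_isRationalOver` + ★ `isStablyConj_iff`),
then for every adelic conjugator `g` of `p`: `x_g = t⋆ · ((H⁻¹ H_{g₀}) ⊗ 1) · t` with `t ∈ Z(γ₀ ⊗ 1)` — the adelic class of a rational class is the image of a GLOBAL
Cartan class modulo norms.  (Prop. 3.3.1 (←): a global class has trivial total norm-residue symbol by reciprocity.) [cite: Rogawski1990, §3.3 Prop. 3.3.1 p. 22]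
[cite: Kottwitz1986, §9] -/
theorem exists_commute_adelicCartan_eq_map_of_isRationalOver (hH : IsUnit H.det) {p : MatchingAdeleG₂ L H H γ₀} {γ : (UnitaryGroup.cmDatum L 3 H).Rational}
    (hp : p.IsRationalOver γ) {g₀ : GL (Fin 3) L}
    (hg₀ : g₀ * ((γ₀ : unitaryGroup (cmConjRingHom L) H).val : GL (Fin 3) L) * g₀⁻¹ = ((γ : unitaryGroup (cmConjRingHom L) H).val : GL (Fin 3) L))
    {g : GL (Fin 3) (AdeleRing (𝓞 L) L)}
    (hg : g * (((UnitaryGroup.cmDatum L 3 H).toAdelic γ₀).val : GL (Fin 3) (AdeleRing (𝓞 L) L)) * g⁻¹ = (p.adele.val : GL (Fin 3) (AdeleRing (𝓞 L) L))) :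
    ∃ t : GL (Fin 3) (AdeleRing (𝓞 L) L),
      t * (((UnitaryGroup.cmDatum L 3 H).toAdelic γ₀).val : GL (Fin 3) (AdeleRing (𝓞 L) L)) =
          (((UnitaryGroup.cmDatum L 3 H).toAdelic γ₀).val : GL (Fin 3) (AdeleRing (𝓞 L) L)) * t ∧
        (H.map (algebraMap L (AdeleRing (𝓞 L) L)))⁻¹ * twistGram (adeleConj L) (H.map (algebraMap L (AdeleRing (𝓞 L) L))) (g : Matrix (Fin 3) (Fin 3) (AdeleRing (𝓞 L) L)) =
          hermStar (adeleConj L) (H.map (algebraMap L (AdeleRing (𝓞 L) L))) (t : Matrix (Fin 3) (Fin 3) (AdeleRing (𝓞 L) L)) *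
            (H⁻¹ * twistGram (cmConjRingHom L) H (g₀ : Matrix (Fin 3) (Fin 3) L)).map (algebraMap L (AdeleRing (𝓞 L) L)) *
            (t : Matrix (Fin 3) (Fin 3) (AdeleRing (𝓞 L) L)) := by
  -- `toAdeleGL g₀` conjugates `γ₀ ⊗ 1` to `γ ⊗ 1`; `p = u (γ ⊗ 1) u⁻¹` with `u ∈ U(H)(𝐀)`; so `u · toAdeleGL g₀` is an adelic conjugator of `p` with class `x_{g₀} ⊗ 1`
  obtain ⟨u, hu⟩ := isConj_iff.mp hp
  have hu' : (u.val : GL (Fin 3) (AdeleRing (𝓞 L) L)) * (((UnitaryGroup.cmDatum L 3 H).toAdelic γ).val : GL (Fin 3) (AdeleRing (𝓞 L) L)) *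
      (u.val : GL (Fin 3) (AdeleRing (𝓞 L) L))⁻¹ = (p.adele.val : GL (Fin 3) (AdeleRing (𝓞 L) L)) := by
    have := congrArg (fun a : (UnitaryGroup.cmDatum L 3 H).Adelic => (a.val : GL (Fin 3) (AdeleRing (𝓞 L) L))) hu
    exact this
  have h₀ : toAdeleGL L g₀ * (((UnitaryGroup.cmDatum L 3 H).toAdelic γ₀).val : GL (Fin 3) (AdeleRing (𝓞 L) L)) * (toAdeleGL L g₀)⁻¹ =
      (((UnitaryGroup.cmDatum L 3 H).toAdelic γ).val : GL (Fin 3) (AdeleRing (𝓞 L) L)) := by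
    rw [UnitaryGroup.coe_cmDatum_toAdelic, UnitaryGroup.coe_cmDatum_toAdelic, ← map_inv, ← map_mul, ← map_mul, hg₀]
  obtain ⟨h₁, hx⟩ := twistGram_eq_of_unitary_conj (adeleConj L) (H.map (algebraMap L (AdeleRing (𝓞 L) L)))
    (γ := ((UnitaryGroup.cmDatum L 3 H).toAdelic γ₀).val) u.2 h₀
  rw [hu'] at h₁
  obtain ⟨t, ht, hcl⟩ := exists_commute_adelicCartan_eq_of_conj_eq hH p h₁ hg
  refine ⟨t, ht, ?_⟩
  rw [hcl, hx, Matrix.map_mul, twistGram_map_adele, Literature.LinearAlgebra.Matrix.map_nonsing_inv_of_isUnit _ hH, val_toAdeleGL]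

/-- The same with the GLOBAL conjugator produced from rationality (★ `isStablyConj_of_isRationalOver`): `∃ g₀ ∈ GL₃(L)` with `g₀ γ₀ g₀⁻¹ = γ` and `∃ t ∈ Z(γ₀ ⊗ 1)`,
`x_g = t⋆ · ((H⁻¹ H_{g₀}) ⊗ 1) · t`. [cite: Rogawski1990, §3.3 Prop. 3.3.1 p. 22] -/
theorem exists_exists_commute_adelicCartan_eq_map_of_isRationalOver (hH : IsUnit H.det) {p : MatchingAdeleG₂ L H H γ₀}
    {γ : (UnitaryGroup.cmDatum L 3 H).Rational} (hp : p.IsRationalOver γ) {g : GL (Fin 3) (AdeleRing (𝓞 L) L)}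
    (hg : g * (((UnitaryGroup.cmDatum L 3 H).toAdelic γ₀).val : GL (Fin 3) (AdeleRing (𝓞 L) L)) * g⁻¹ = (p.adele.val : GL (Fin 3) (AdeleRing (𝓞 L) L))) :
    ∃ g₀ : GL (Fin 3) L, g₀ * ((γ₀ : unitaryGroup (cmConjRingHom L) H).val : GL (Fin 3) L) * g₀⁻¹ = ((γ : unitaryGroup (cmConjRingHom L) H).val : GL (Fin 3) L) ∧
      ∃ t : GL (Fin 3) (AdeleRing (𝓞 L) L),
        t * (((UnitaryGroup.cmDatum L 3 H).toAdelic γ₀).val : GL (Fin 3) (AdeleRing (𝓞 L) L)) =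
            (((UnitaryGroup.cmDatum L 3 H).toAdelic γ₀).val : GL (Fin 3) (AdeleRing (𝓞 L) L)) * t ∧
          (H.map (algebraMap L (AdeleRing (𝓞 L) L)))⁻¹ * twistGram (adeleConj L) (H.map (algebraMap L (AdeleRing (𝓞 L) L))) (g : Matrix (Fin 3) (Fin 3) (AdeleRing (𝓞 L) L)) =
            hermStar (adeleConj L) (H.map (algebraMap L (AdeleRing (𝓞 L) L))) (t : Matrix (Fin 3) (Fin 3) (AdeleRing (𝓞 L) L)) *
              (H⁻¹ * twistGram (cmConjRingHom L) H (g₀ : Matrix (Fin 3) (Fin 3) L)).map (algebraMap L (AdeleRing (𝓞 L) L)) *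
              (t : Matrix (Fin 3) (Fin 3) (AdeleRing (𝓞 L) L)) := by
  obtain ⟨g₀, hg₀⟩ := isStablyConj_iff.mp (p.isStablyConj_of_isRationalOver hp)
  exact ⟨g₀, hg₀, exists_commute_adelicCartan_eq_map_of_isRationalOver hH hp hg₀ hg⟩

end Self

end Literature.NumberTheory.Rogawski1990

end
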